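import Literature.Geometry.Lorentzian.GreenIdentity
import HarnessLib

/-!
# Green's first identity for compactly supported functions on a (non-compact) Riemannian
# manifold: `∫_N u Δ_h f dμ_h = −∫_N h⁻¹(du, df) dμ_h`

`GreenIdentity.lean` proves Green's first identity `∫_N u Δ_h f dμ_h = −∫_N h⁻¹(du, df) dμ_h`
on a **compact** Riemannian manifold without boundary (Lee 2018, Problem 2-23 (a)). Analysis on
asymptotically flat manifolds (Schoen–Yau 1979, §3: the weak form of `Δv − fv = h`, (3.2), and
of the conformal equation `Δφ = Rφ/8`, (3.22), tested against functions "with compact support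
on `N`"; the flux computation of the mass term `A = −(1/4π) ∫_N (fv + h)`, (3.16)) needs the same
identity on a **non-compact** manifold for compactly supported `u` — the boundary term still
vanishes. This file proves it, by the argument of `GreenIdentity.lean` verbatim with the compactness
of `N` replaced by the compactness of `tsupport u` (all results proved, no named facts):

* `integral_mul_dalembertian_of_hasCompactSupport_of_tsupport_subset` — the identity for
  `w ∈ C¹_c(N)` supported in one chart domain (the chart computation of
  `integral_mul_dalembertian_of_tsupport_subset`, which carries the whole analysis: measure and
  Laplacian in the chart, divergence form, integration by parts on `ℝ^m`);
* `integral_mul_dalembertian_eq_neg_integral_innerDual_of_hasCompactSupport` — **Green's first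
  identity for `u ∈ C¹_c(N)`, `f ∈ C²(N)`** on any Riemannian manifold modelled on `ℝ^m`
  (a finite smooth partition of unity on the compact `tsupport u` subordinate to chart domains);
* `integral_dalembertian_mul_eq_neg_integral_innerDual_of_hasCompactSupport` — the same with the
  compact support on `f ∈ C²_c(N)` and `u ∈ C¹(N)` arbitrary (cut `u` off by a smooth bump equal
  to `1` near `tsupport f`);
* `integral_dalembertian_eq_zero_of_hasCompactSupport` — `∫_N Δ_h f dμ_h = 0` for `f ∈ C²_c(N)`.

Hypotheses: `N` a `C^∞` manifold modelled on `EuclideanSpace ℝ (Fin m)` (boundaryless model),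
`[T2Space N] [LocallyCompactSpace N] [MeasurableSpace N] [BorelSpace N]`, `h` a smooth Riemannian
metric with `[(ofRiemannian h).HasLeviCivita]`; the Riemannian measure is finite on compact sets
(`riemannianVolume_lt_top_of_isCompact_holds`), which replaces the finiteness used in the compact
case.

## References

* J. M. Lee, *Introduction to Riemannian Manifolds*, 2nd ed., GTM 176, Springer 2018,
  Problem 2-23 (a) and Prop. 2.46 (key `Lee2018`).
* R. Schoen, S.-T. Yau, *On the proof of the positive mass conjecture in general relativity*,
  Comm. Math. Phys. 65 (1979) 45–76, §3, Lemma 3.1 ("functions with compact support on `N`"),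
  (3.2), (3.16), (3.22).
-/

noncomputable section

open Bundle Set Function Filter Manifold MeasureTheory Finset
open scoped Manifold ContDiff Topology Matrix ENNReal

namespace Literature.Geometry.Lorentzian

open PseudoRiemannianMetric

section Core

variable {m : ℕ} {H : Type*} [TopologicalSpace H]
  {I : ModelWithCorners ℝ (EuclideanSpace ℝ (Fin m)) H} [I.Boundaryless]
  {N : Type*} [TopologicalSpace N] [ChartedSpace H N] [IsManifold I ∞ N]
  [T2Space N] [LocallyCompactSpace N] [MeasurableSpace N] [BorelSpace N]
  (h : ContMDiffRiemannianMetric I ∞ (EuclideanSpace ℝ (Fin m)) (TangentSpace I : N → Type _))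
  [(ofRiemannian h).HasLeviCivita]

/-- **Green's first identity for a compactly supported function supported in a chart domain**
(on a possibly non-compact manifold). For `w ∈ C¹(N)` with compact `tsupport w` inside the chart
domain of `x` and `f ∈ C²(N)`: `∫_N w Δ_h f dμ_h = −∫_N h⁻¹(dw, df) dμ_h`. The proof is that of
`integral_mul_dalembertian_of_tsupport_subset` (`GreenIdentity.lean`: chart formula for the
measure, `dalembertian_eq_sum_localFrame`, divergence form
`coordLaplacian_mul_sqrt_det_eq_sum_fderiv`, integration by parts on `ℝ^m` against the zero
extension of `w ∘ φ⁻¹`), the compactness of `N` being used there only through the compactness of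
`tsupport w` and the finiteness of `μ_h` on it. Lee 2018, Problem 2-23 (a), Prop. 2.46.
[cite: Lee2018, Problem 2-23 (a) and Prop. 2.46] -/
theorem integral_mul_dalembertian_of_hasCompactSupport_of_tsupport_subset (x : N) {w f : N → ℝ}
    (hw : CMDiff 1 w) (hwc : HasCompactSupport w) (hf : CMDiff 2 f)
    (hsupp : tsupport w ⊆ (chartAt H x).source) :
    ∫ p, w p * (ofRiemannian h).dalembertian f p ∂riemannianMeasure h =
      -∫ p, (ofRiemannian h).innerDual p (mvfderiv I w p).toLinearMap (mvfderiv I f p).toLinearMap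
        ∂riemannianMeasure h := by
  classical
  -- notation: the model space, its standard basis, the chart and its target
  set b : Module.Basis (Fin m) ℝ (EuclideanSpace ℝ (Fin m)) := (EuclideanSpace.basisFun (Fin m) ℝ).toBasis
    with hb_def
  have hb : ∀ i, b i = EuclideanSpace.single i 1 := fun i ↦ by
    simp [hb_def]
  obtain ⟨φ, hφ⟩ : ∃ φ : PartialEquiv N (EuclideanSpace ℝ (Fin m)), φ = extChartAt I x := ⟨_, rfl⟩
  obtain ⟨T, hTdef⟩ : ∃ T : Set (EuclideanSpace ℝ (Fin m)), T = (extChartAt I x).target := ⟨_, rfl⟩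
  have hT : IsOpen T := by rw [hTdef]; exact isOpen_extChartAt_target x
  have hTm : MeasurableSet T := hT.measurableSet
  have hsrc : (chartAt H x).source = (extChartAt I x).source :=
    (extChartAt_source (I := I) (x := x)).symm
  have hsuppS : tsupport w ⊆ (extChartAt I x).source := hsrc ▸ hsupp
  -- the compact set `K = φ (tsupport w) ⊆ T`
  obtain ⟨K, hKdef⟩ : ∃ K : Set (EuclideanSpace ℝ (Fin m)), K = extChartAt I x '' tsupport w :=
    ⟨_, rfl⟩
  have hKc : IsCompact K := by
    rw [hKdef]
    exact hwc.isCompact.image_of_continuousOn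
      ((continuousOn_extChartAt x).mono hsuppS)
  have hKT : K ⊆ T := by
    rw [hKdef, hTdef]
    rintro _ ⟨p, hp, rfl⟩
    exact (extChartAt I x).map_source (hsuppS hp)
  -- the chart representatives
  obtain ⟨Gh, hGh⟩ : ∃ Gh : EuclideanSpace ℝ (Fin m) → Fin m → Fin m → ℝ,
      Gh = fun y i j ↦ chartGramMatrix h x y i j := ⟨_, rfl⟩
  have hofG : ∀ y, Matrix.of (Gh y) = chartGramMatrix h x y := fun y ↦ by
    rw [hGh]; rfl
  obtain ⟨fh, hfh⟩ : ∃ fh : EuclideanSpace ℝ (Fin m) → ℝ, fh = f ∘ (extChartAt I x).symm := ⟨_, rfl⟩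
  obtain ⟨F, hF⟩ : ∃ F : EuclideanSpace ℝ (Fin m) → ℝ, F = T.indicator (w ∘ (extChartAt I x).symm) :=
    ⟨_, rfl⟩
  obtain ⟨W, hW⟩ : ∃ W : Fin m → EuclideanSpace ℝ (Fin m) → ℝ, W = fun i y ↦
      Real.sqrt (Matrix.of (Gh y)).det * ∑ l, (Matrix.of (Gh y))⁻¹ i l * fderiv ℝ fh y (b l) :=
    ⟨_, rfl⟩
  -- `F` vanishes off `K` and agrees with `ŵ` on `T`
  have hFT : ∀ y ∈ T, F y = w ((extChartAt I x).symm y) := fun y hy ↦ by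
    rw [hF, indicator_of_mem hy]; rfl
  have hF0 : ∀ y ∉ K, F y = 0 := by
    intro y hyK
    by_cases hyT : y ∈ T
    · rw [hFT y hyT]
      refine image_eq_zero_of_notMem_tsupport (fun hmem ↦ hyK ?_)
      rw [hKdef]
      refine ⟨_, hmem, (extChartAt I x).right_inv ?_⟩
      rwa [hTdef] at hyT
    · rw [hF, indicator_of_notMem hyT]
  have hsuppF : tsupport F ⊆ K :=
    closure_minimal (fun y hy ↦ by_contra fun hyK ↦ hy (hF0 y hyK)) hKc.isClosed
  -- regularity of the representatives on `T`
  have hŵ1 : ContDiffOn ℝ 1 (w ∘ (extChartAt I x).symm) T := by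
    rw [hTdef]; exact contDiffOn_comp_extChartAt_symm hw
  have hF1 : ContDiff ℝ 1 F :=
    contDiff_of_contDiffOn_of_eq_zero hT hKc hKT (hŵ1.congr fun y hy ↦ hFT y hy) hF0
  have hfh2 : ContDiffOn ℝ 2 fh T := by
    rw [hfh, hTdef]; exact contDiffOn_comp_extChartAt_symm hf
  have hGT : ∀ y ∈ T, ∀ i j, Gh y i j = (ofRiemannian h).val ((extChartAt I x).symm y)
      ((trivializationAt (EuclideanSpace ℝ (Fin m)) (TangentSpace I) x).localFrame b i
        ((extChartAt I x).symm y))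
      ((trivializationAt (EuclideanSpace ℝ (Fin m)) (TangentSpace I) x).localFrame b j
        ((extChartAt I x).symm y)) := by
    intro y hy i j
    rw [hGh]
    exact chartGramMatrix_apply_eq_val_localFrame h x (hTdef ▸ hy) i j
  have hGsm : ∀ i j, ContDiffOn ℝ ∞ (fun y ↦ Gh y i j) T := fun i j ↦ by
    rw [hTdef]
    exact (contDiffOn_gram_comp_extChartAt_symm b (ofRiemannian h) i j).congr
      (fun y hy ↦ hGT y (hTdef ▸ hy) i j)
  have hGpi : ContDiffOn ℝ ∞ Gh T :=
    contDiffOn_pi.2 fun i ↦ contDiffOn_pi.2 fun j ↦ hGsm i j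
  have hGsym : ∀ z i j, Gh z i j = Gh z j i := fun z i j ↦ by
    rw [hGh]; exact chartGramMatrix_apply_comm h x z i j
  have hdetpos : ∀ y ∈ T, 0 < (Matrix.of (Gh y)).det := fun y hy ↦ by
    rw [hofG]
    exact Real.sqrt_pos.1 (sqrt_det_chartGramMatrix_pos h x (hTdef ▸ hy))
  have hGdet : ContDiffOn ℝ ∞ (fun y ↦ (Matrix.of (Gh y)).det) T := by
    intro y hy
    have h1 := contMDiffAt_matrix_det (I := 𝓘(ℝ, EuclideanSpace ℝ (Fin m))) (k := ∞)
      (A := fun y ↦ Matrix.of (Gh y)) (x₀ := y)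
      (fun i j ↦ contMDiffAt_iff_contDiffAt.2 ((hGsm i j).contDiffAt (hT.mem_nhds hy)))
    exact (contMDiffAt_iff_contDiffAt.1 h1).contDiffWithinAt
  have hρ : ContDiffOn ℝ ∞ (fun y ↦ Real.sqrt (Matrix.of (Gh y)).det) T :=
    hGdet.sqrt fun y hy ↦ (hdetpos y hy).ne'
  have hGinv : ∀ i l, ContDiffOn ℝ ∞ (fun y ↦ (Matrix.of (Gh y))⁻¹ i l) T := by
    intro i l y hy
    have h1 := contMDiffAt_matrix_inv (I := 𝓘(ℝ, EuclideanSpace ℝ (Fin m))) (k := ∞)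
      (A := fun y ↦ Matrix.of (Gh y)) (x₀ := y)
      (fun i j ↦ contMDiffAt_iff_contDiffAt.2 ((hGsm i j).contDiffAt (hT.mem_nhds hy)))
      (hdetpos y hy).ne' i l
    exact (contMDiffAt_iff_contDiffAt.1 h1).contDiffWithinAt
  have hdfh : ∀ l, ContDiffOn ℝ 1 (fun y ↦ fderiv ℝ fh y (b l)) T := fun l ↦
    (hfh2.fderiv_of_isOpen hT (by norm_num)).clm_apply contDiffOn_const
  have hW1 : ∀ i, ContDiffOn ℝ 1 (W i) T := by
    intro i
    rw [hW]
    exact (hρ.of_le (by simp)).mul (ContDiffOn.sum fun l _ ↦ ((hGinv i l).of_le (by simp)).mul (hdfh l))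
  have hWc : ∀ i, ContinuousOn (W i) T := fun i ↦ (hW1 i).continuousOn
  have hWd : ∀ i, ∀ y ∈ T, DifferentiableAt ℝ (W i) y := fun i y hy ↦
    ((hW1 i).contDiffAt (hT.mem_nhds hy)).differentiableAt one_ne_zero
  have hdWc : ∀ i (v : EuclideanSpace ℝ (Fin m)), ContinuousOn (fun y ↦ fderiv ℝ (W i) y v) T :=
    fun i v ↦ ((hW1 i).continuousOn_fderiv_of_isOpen hT le_rfl).clm_apply continuousOn_const
  have hFc : Continuous F := hF1.continuous
  have hFd : Differentiable ℝ F := hF1.differentiable one_ne_zero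
  have hdFc : ∀ v : EuclideanSpace ℝ (Fin m), Continuous (fun y ↦ fderiv ℝ F y v) := fun v ↦
    (hF1.continuous_fderiv one_ne_zero).clm_apply continuous_const
  have hdF0 : ∀ (v : EuclideanSpace ℝ (Fin m)), ∀ y ∉ K, fderiv ℝ F y v = 0 := fun v y hy ↦ by
    rw [fderiv_eq_zero_of_eq_zero hKc hF0 hy]; rfl
  -- points of `T` correspond to points of the chart domain
  have hmemS : ∀ y ∈ T, (extChartAt I x).symm y ∈ (chartAt H x).source := fun y hy ↦ by
    rw [hsrc]; exact (extChartAt I x).map_target (hTdef ▸ hy)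
  have hright : ∀ y ∈ T, extChartAt I x ((extChartAt I x).symm y) = y := fun y hy ↦
    (extChartAt I x).right_inv (hTdef ▸ hy)
  have hTnhds : ∀ y ∈ T, T ∈ 𝓝 y := fun y hy ↦ hT.mem_nhds hy
  -- (1) the Laplacian in the chart, in divergence form: `√g Δf ∘ φ⁻¹ = ∑ᵢ ∂ᵢ Wᵢ` on `T`
  have hΔ : ∀ y ∈ T, Real.sqrt (Matrix.of (Gh y)).det *
      (ofRiemannian h).dalembertian f ((extChartAt I x).symm y) = ∑ i, fderiv ℝ (W i) y (b i) := by
    intro y hy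
    have hGy : HasFDerivAt Gh (fderiv ℝ Gh y) y :=
      ((hGpi.contDiffAt (hTnhds y hy)).differentiableAt (by simp)).hasFDerivAt
    have hf2y : HasFDerivAt (fun z ↦ fderiv ℝ fh z) (fderiv ℝ (fderiv ℝ fh) y) y :=
      (((hfh2.fderiv_of_isOpen (m := 1) hT (by norm_num)).contDiffAt (hTnhds y hy)).differentiableAt
        one_ne_zero).hasFDerivAt
    -- the coordinate formula for `Δ`
    have hL := dalembertian_eq_sum_localFrame (ofRiemannian h) b (hmemS y hy)
      (hf ((extChartAt I x).symm y)) (Gh := Gh) (fh := fh) (by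
        rw [hright y hy]
        filter_upwards [hTnhds y hy] with z hz
        exact hGT z hz) (by rw [hright y hy, hfh])
    rw [hright y hy] at hL
    -- the divergence form
    have hC := Literature.Analysis.Calculus.coordLaplacian_mul_sqrt_det_eq_sum_fderiv b hGy hGsym
      (hdetpos y hy) hf2y
    rw [hL]
    simp only [Literature.Analysis.Calculus.fderiv_apply_apply_eq hGy] at hC ⊢
    rw [hC, hW]
  -- (2) the integrand `∑ᵢ ∂ᵢF · Wᵢ` is `√g · h⁻¹(dw, df) ∘ φ⁻¹` on `T`
  have hIpt : ∀ y ∈ T, ∑ i, fderiv ℝ F y (b i) * W i y = Real.sqrt (Matrix.of (Gh y)).det *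
      (ofRiemannian h).innerDual ((extChartAt I x).symm y)
        (mvfderiv I w ((extChartAt I x).symm y)).toLinearMap
        (mvfderiv I f ((extChartAt I x).symm y)).toLinearMap := by
    intro y hy
    have hIy := innerDual_mvfderiv_eq_sum_localFrame (ofRiemannian h) b (hmemS y hy)
      ((hw _).mdifferentiableAt one_ne_zero) ((hf _).mdifferentiableAt (by simp))
      (uh := F) (vh := fh) (by
        rw [hright y hy]
        filter_upwards [hTnhds y hy] with z hz
        exact hFT z hz) (by rw [hright y hy, hfh])
    rw [hright y hy] at hIy
    have hmat : (Matrix.of fun i j ↦ (ofRiemannian h).val ((extChartAt I x).symm y)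
        ((trivializationAt (EuclideanSpace ℝ (Fin m)) (TangentSpace I) x).localFrame b i
          ((extChartAt I x).symm y))
        ((trivializationAt (EuclideanSpace ℝ (Fin m)) (TangentSpace I) x).localFrame b j
          ((extChartAt I x).symm y))) = Matrix.of (Gh y) := by
      ext i j
      simp only [Matrix.of_apply, hGT y hy]
    rw [hmat] at hIy
    rw [hIy, hW, Finset.mul_sum]
    simp only [Finset.mul_sum]
    refine Finset.sum_congr rfl (fun i _ ↦ Finset.sum_congr rfl (fun l _ ↦ ?_))
    ring
  -- (3) integrability on `ℝ^m` of the three products entering the integration by parts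
  have hint1 : ∀ i, Integrable (fun y ↦ fderiv ℝ F y (b i) * W i y) := fun i ↦
    (continuous_mul_of_eq_zero hT hKc hKT (hdFc (b i)) (hdF0 (b i)) (hWc i)).integrable_of_hasCompactSupport
      (hasCompactSupport_mul_of_eq_zero hKc (hdF0 (b i)) (W i))
  have hint2 : ∀ i, Integrable (fun y ↦ F y * fderiv ℝ (W i) y (b i)) := fun i ↦
    (continuous_mul_of_eq_zero hT hKc hKT hFc hF0 (hdWc i (b i))).integrable_of_hasCompactSupport
      (hasCompactSupport_mul_of_eq_zero hKc hF0 _)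
  have hint3 : ∀ i, Integrable (fun y ↦ F y * W i y) := fun i ↦
    (continuous_mul_of_eq_zero hT hKc hKT hFc hF0 (hWc i)).integrable_of_hasCompactSupport
      (hasCompactSupport_mul_of_eq_zero hKc hF0 _)
  -- (4) integration by parts on `ℝ^m`
  have hIBP : ∀ i, ∫ y, F y * fderiv ℝ (W i) y (b i) = -∫ y, fderiv ℝ F y (b i) * W i y := fun i ↦
    integral_mul_fderiv_eq_neg_fderiv_mul_of_integrable (hint1 i) (hint2 i) (hint3 i)
      (fun y _ ↦ hFd y) (fun y hy ↦ hWd i y (hKT (hsuppF hy)))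
  -- (5) the left-hand side in the chart
  haveI : IsFiniteMeasureOnCompacts (riemannianMeasure h) :=
    ⟨fun K hK ↦ riemannianVolume_lt_top_of_isCompact_holds h le_rfl hK⟩
  have hΔc : Continuous ((ofRiemannian h).dalembertian f) := continuous_dalembertian _ hf
  have hLHS : ∫ p, w p * (ofRiemannian h).dalembertian f p ∂riemannianMeasure h =
      ∫ y in T, F y * ∑ i, fderiv ℝ (W i) y (b i) := by
    have hmeas : Measurable (fun p ↦ w p * (ofRiemannian h).dalembertian f p) :=
      (hw.continuous.mul hΔc).measurable
    have hsup : support (fun p ↦ w p * (ofRiemannian h).dalembertian f p) ⊆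
        (extChartAt I x).source := by
      intro p hp
      rw [mem_support] at hp
      exact hsuppS (subset_tsupport _ (left_ne_zero_of_mul hp))
    rw [integral_eq_integral_chart h x hmeas hsup, ← hTdef]
    refine setIntegral_congr_fun hTm (fun y hy ↦ ?_)
    simp only [smul_eq_mul]
    rw [← hofG, hFT y hy, ← hΔ y hy]
    ring
  -- (6) the right-hand side in the chart
  have hIc : Continuous (fun p ↦ (ofRiemannian h).innerDual p (mvfderiv I w p).toLinearMap
      (mvfderiv I f p).toLinearMap) :=
    continuous_innerDual_mvfderiv _ hw (hf.of_le (by norm_num))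
  have hRHS : ∫ p, (ofRiemannian h).innerDual p (mvfderiv I w p).toLinearMap
      (mvfderiv I f p).toLinearMap ∂riemannianMeasure h =
      ∫ y in T, ∑ i, fderiv ℝ F y (b i) * W i y := by
    have hsup : support (fun p ↦ (ofRiemannian h).innerDual p (mvfderiv I w p).toLinearMap
        (mvfderiv I f p).toLinearMap) ⊆ (extChartAt I x).source := by
      intro p hp
      rw [mem_support] at hp
      refine hsuppS (by_contra fun hnot ↦ hp ?_)
      rw [mvfderiv_eq_zero_of_notMem_tsupport hnot]
      simp [PseudoRiemannianMetric.innerDual]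
    rw [integral_eq_integral_chart h x hIc.measurable hsup, ← hTdef]
    refine setIntegral_congr_fun hTm (fun y hy ↦ ?_)
    rw [smul_eq_mul, ← hofG, hIpt y hy]
  -- (7) assemble
  rw [hLHS, hRHS]
  have hint2' : ∀ i, IntegrableOn (fun y ↦ F y * fderiv ℝ (W i) y (b i)) T := fun i ↦
    (hint2 i).integrableOn
  calc ∫ y in T, F y * ∑ i, fderiv ℝ (W i) y (b i)
      = ∫ y in T, ∑ i, F y * fderiv ℝ (W i) y (b i) := by
        simp only [Finset.mul_sum]
    _ = ∑ i, ∫ y in T, F y * fderiv ℝ (W i) y (b i) := integral_finsetSum _ (fun i _ ↦ hint2' i)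
    _ = ∑ i, ∫ y, F y * fderiv ℝ (W i) y (b i) := by
        refine Finset.sum_congr rfl (fun i _ ↦ ?_)
        refine setIntegral_eq_integral_of_forall_compl_eq_zero (fun y hy ↦ ?_)
        rw [hF0 y (fun hK ↦ hy (hKT hK)), zero_mul]
    _ = ∑ i, -∫ y, fderiv ℝ F y (b i) * W i y := Finset.sum_congr rfl (fun i _ ↦ hIBP i)
    _ = -∫ y, ∑ i, fderiv ℝ F y (b i) * W i y := by
        rw [Finset.sum_neg_distrib, integral_finsetSum _ (fun i _ ↦ hint1 i)]
    _ = -∫ y in T, ∑ i, fderiv ℝ F y (b i) * W i y := by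
        congr 1
        refine (setIntegral_eq_integral_of_forall_compl_eq_zero (fun y hy ↦ ?_)).symm
        exact Finset.sum_eq_zero (fun i _ ↦ by
          rw [hdF0 (b i) y (fun hK ↦ hy (hKT hK)), zero_mul])


omit [I.Boundaryless] [(ofRiemannian h).HasLeviCivita] in
/-- Continuous compactly supported functions are integrable for the Riemannian measure (which is
finite on compact sets, `riemannianVolume_lt_top_of_isCompact_holds`). [folklore] -/
theorem integrable_of_continuous_of_hasCompactSupport {F : N → ℝ} (hF : Continuous F)
    (hFc : HasCompactSupport F) : Integrable F (riemannianMeasure h) := by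
  haveI : IsFiniteMeasureOnCompacts (riemannianMeasure h) :=
    ⟨fun K hK ↦ riemannianVolume_lt_top_of_isCompact_holds h le_rfl hK⟩
  exact hF.integrable_of_hasCompactSupport hFc

/-- **Green's first identity for compactly supported `u` on a Riemannian manifold.** Let `(N, h)`
be a Riemannian manifold without boundary modelled on `ℝ^m` (not necessarily compact; Hausdorff,
locally compact, σ-compact), `u ∈ C¹_c(N)` and `f ∈ C²(N)`. Then
`∫_N u Δ_h f dμ_h = −∫_N h⁻¹(du, df) dμ_h`, with `Δ_h = tr_h Hess` (`dalembertian`), `h⁻¹` the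
inverse metric on covectors (`innerDual`) and `μ_h` the Riemannian measure. Proof: a finite smooth
partition of unity on the compact set `tsupport u` subordinate to finitely many chart domains
(Mathlib's `SmoothPartitionOfUnity.exists_isSubordinate`) reduces, by linearity, to
`integral_mul_dalembertian_of_hasCompactSupport_of_tsupport_subset`. This is the integration by
parts behind the weak form of Schoen–Yau's equations (3.2), (3.22) tested against "functions with
compact support on `N`" (Comm. Math. Phys. 65 (1979), §3). Lee 2018, Problem 2-23 (a).
[cite: Lee2018, Problem 2-23 (a)] -/
theorem integral_mul_dalembertian_eq_neg_integral_innerDual_of_hasCompactSupport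
    [SigmaCompactSpace N] {u f : N → ℝ} (hu : CMDiff 1 u) (huc : HasCompactSupport u)
    (hf : CMDiff 2 f) :
    ∫ p, u p * (ofRiemannian h).dalembertian f p ∂riemannianMeasure h =
      -∫ p, (ofRiemannian h).innerDual p (mvfderiv I u p).toLinearMap (mvfderiv I f p).toLinearMap
        ∂riemannianMeasure h := by
  classical
  -- a finite cover of `tsupport u` by chart domains and a smooth partition of unity on it
  obtain ⟨t, -, ht⟩ := huc.isCompact.elim_nhds_subcover (fun x : N ↦ (chartAt H x).source)
    (fun x _ ↦ (chartAt H x).open_source.mem_nhds (mem_chart_source H x))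
  obtain ⟨ρ, hρ⟩ := SmoothPartitionOfUnity.exists_isSubordinate I (isClosed_tsupport u)
    (fun i : t ↦ (chartAt H (i : N)).source) (fun i ↦ (chartAt H (i : N)).open_source) (by
      intro p hp
      have hp' : p ∈ ⋃ x ∈ t, (chartAt H x).source := ht hp
      simp only [mem_iUnion] at hp' ⊢
      obtain ⟨x, hx, hpx⟩ := hp'
      exact ⟨⟨x, hx⟩, hpx⟩)
  have hsum : ∀ p ∈ tsupport u, ∑ i, ρ i p = 1 := fun p hp ↦ by
    rw [← finsum_eq_sum_of_fintype]
    exact ρ.sum_eq_one hp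
  -- `u = ∑ᵢ ρᵢ u` everywhere (off `tsupport u` both sides vanish)
  have hdecomp : ∀ p, u p = ∑ i, ρ i p * u p := fun p ↦ by
    by_cases hp : p ∈ tsupport u
    · rw [← Finset.sum_mul, hsum p hp, one_mul]
    · rw [image_eq_zero_of_notMem_tsupport hp]
      simp
  have hρ1 : ∀ i, CMDiff 1 (ρ i) := fun i ↦ (ρ i).contMDiff.of_le (by exact_mod_cast le_top)
  have hw : ∀ i, CMDiff 1 (fun p ↦ ρ i p * u p) := fun i ↦ (hρ1 i).mul hu
  have hwc : ∀ i, HasCompactSupport (fun p ↦ ρ i p * u p) := fun i ↦ huc.mul_left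
  have hwsupp : ∀ i, tsupport (fun p ↦ ρ i p * u p) ⊆ (chartAt H (i : N)).source := fun i ↦
    (tsupport_mul_subset_left).trans (hρ i)
  -- Green's identity for each piece `ρᵢ u`
  have hpiece : ∀ i, ∫ p, (ρ i p * u p) * (ofRiemannian h).dalembertian f p ∂riemannianMeasure h =
      -∫ p, (ofRiemannian h).innerDual p (mvfderiv I (fun p ↦ ρ i p * u p) p).toLinearMap
        (mvfderiv I f p).toLinearMap ∂riemannianMeasure h :=
    fun i ↦ integral_mul_dalembertian_of_hasCompactSupport_of_tsupport_subset h (i : N) (hw i)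
      (hwc i) hf (hwsupp i)
  -- continuity and compact support (hence integrability) of the integrands
  have hΔc : Continuous ((ofRiemannian h).dalembertian f) := continuous_dalembertian _ hf
  have hIc : ∀ i, Continuous (fun p ↦ (ofRiemannian h).innerDual p
      (mvfderiv I (fun p ↦ ρ i p * u p) p).toLinearMap (mvfderiv I f p).toLinearMap) :=
    fun i ↦ continuous_innerDual_mvfderiv _ (hw i) (hf.of_le (by norm_num))
  have hIsupp : ∀ i, HasCompactSupport (fun p ↦ (ofRiemannian h).innerDual p
      (mvfderiv I (fun p ↦ ρ i p * u p) p).toLinearMap (mvfderiv I f p).toLinearMap) := by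
    intro i
    refine (hwc i).mono' (fun p hp ↦ ?_)
    rw [mem_support] at hp
    by_contra hnot
    apply hp
    rw [mvfderiv_eq_zero_of_notMem_tsupport hnot]
    simp [PseudoRiemannianMetric.innerDual]
  -- linearity on the left
  have hL : ∫ p, u p * (ofRiemannian h).dalembertian f p ∂riemannianMeasure h =
      ∑ i, ∫ p, (ρ i p * u p) * (ofRiemannian h).dalembertian f p ∂riemannianMeasure h := by
    have heq : (fun p ↦ u p * (ofRiemannian h).dalembertian f p) =
        fun p ↦ ∑ i, (ρ i p * u p) * (ofRiemannian h).dalembertian f p := by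
      funext p
      rw [← Finset.sum_mul, ← hdecomp p]
    rw [heq]
    exact integral_finsetSum _ (fun i _ ↦ integrable_of_continuous_of_hasCompactSupport h
      ((hw i).continuous.mul hΔc) ((hwc i).mul_right))
  -- linearity on the right: `du = ∑ᵢ d(ρᵢ u)`
  have hdu : ∀ p, mvfderiv I u p = ∑ i, mvfderiv I (fun p ↦ ρ i p * u p) p := by
    intro p
    have hu' : u = fun q ↦ ∑ i, ρ i q * u q := funext hdecomp
    conv_lhs => rw [hu']
    exact (mvfderiv_finset_sum (I := I) Finset.univ (fun i _ ↦
      ((hw i) p).mdifferentiableAt one_ne_zero)).2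
  have hR : ∫ p, (ofRiemannian h).innerDual p (mvfderiv I u p).toLinearMap
      (mvfderiv I f p).toLinearMap ∂riemannianMeasure h =
      ∑ i, ∫ p, (ofRiemannian h).innerDual p (mvfderiv I (fun p ↦ ρ i p * u p) p).toLinearMap
        (mvfderiv I f p).toLinearMap ∂riemannianMeasure h := by
    have heq : (fun p ↦ (ofRiemannian h).innerDual p (mvfderiv I u p).toLinearMap
        (mvfderiv I f p).toLinearMap) =
        fun p ↦ ∑ i, (ofRiemannian h).innerDual p
          (mvfderiv I (fun p ↦ ρ i p * u p) p).toLinearMap (mvfderiv I f p).toLinearMap := by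
      funext p
      simp only [PseudoRiemannianMetric.innerDual, hdu p, ContinuousLinearMap.coe_coe,
        FunLike.coe_sum, Finset.sum_apply]
    rw [heq]
    exact integral_finsetSum _ (fun i _ ↦ integrable_of_continuous_of_hasCompactSupport h (hIc i)
      (hIsupp i))
  rw [hL, hR, ← Finset.sum_neg_distrib]
  exact Finset.sum_congr rfl (fun i _ ↦ hpiece i)

end Core

/-! ### Locality of the Hessian and of the Laplace–Beltrami operator -/

namespace PseudoRiemannianMetric

section Locality

variable {E : Type*} [NormedAddCommGroup E] [NormedSpace ℝ E] {H : Type*} [TopologicalSpace H]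
  {I : ModelWithCorners ℝ E H} {M : Type*} [TopologicalSpace M] [ChartedSpace H M]
  [IsManifold I ∞ M] {n : ℕ∞ω} [Fact (1 ≤ n)] [FiniteDimensional ℝ E] [CompleteSpace E]
  (g : PseudoRiemannianMetric I n E (TangentSpace I : M → Type _)) [g.HasLeviCivita]

omit [IsManifold I ∞ M] [FiniteDimensional ℝ E] [CompleteSpace E] [Fact (1 ≤ n)]
  [g.HasLeviCivita] in
/-- The differential of a function vanishing near `x` vanishes at `x`. [folklore] -/
theorem mvfderiv_eq_zero_of_eventuallyEq_zero {f : M → ℝ} {x : M} (hf : f =ᶠ[𝓝 x] fun _ ↦ 0) :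
    mvfderiv I f x = 0 := by
  have h0 : mfderiv I 𝓘(ℝ, ℝ) f x = 0 := by
    rw [hf.mfderiv_eq]
    exact mfderiv_const
  ext v
  simp [mvfderiv, h0]

omit [FiniteDimensional ℝ E] [CompleteSpace E] [Fact (1 ≤ n)] in
/-- The bare Hessian operation of a function vanishing near `x` vanishes at `x`: both terms of
`X(Yf)(x) − ((∇_X Y) f)(x)` are derivatives of functions vanishing near `x`. [folklore] -/
theorem hessianAux_eq_zero_of_eventuallyEq_zero {f : M → ℝ} {x : M}
    (hf : f =ᶠ[𝓝 x] fun _ ↦ 0) (X Y : Π x : M, TangentSpace I x) :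
    g.hessianAux f X Y x = 0 := by
  have h1 : (fun y ↦ mvfderiv I f y (Y y)) =ᶠ[𝓝 x] fun _ ↦ 0 := by
    filter_upwards [hf.eventuallyEq_nhds] with y hy
    rw [mvfderiv_eq_zero_of_eventuallyEq_zero hy]
    rfl
  rw [PseudoRiemannianMetric.hessianAux, mvfderiv_eq_zero_of_eventuallyEq_zero h1,
    mvfderiv_eq_zero_of_eventuallyEq_zero hf]
  simp

omit [FiniteDimensional ℝ E] [CompleteSpace E] [Fact (1 ≤ n)] in
/-- **Locality of the Hessian**: the Hessian of a function vanishing near `x` vanishes at `x`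
(O'Neill 1983, Ch. 3, Def. 3.48: `Hess f = ∇(df)` is a tensor field built from the germ of
`f`). [cite: ONeill1983, Ch. 3, Def. 3.48] -/
theorem hessian_eq_zero_of_eventuallyEq_zero {f : M → ℝ} {x : M} (hf : f =ᶠ[𝓝 x] fun _ ↦ 0) :
    g.hessian f x = 0 := by
  have haux : ∀ X Y : Π x : M, TangentSpace I x, g.hessianAux f X Y x = 0 :=
    fun X Y ↦ g.hessianAux_eq_zero_of_eventuallyEq_zero hf X Y
  unfold PseudoRiemannianMetric.hessian
  have hex : ∃ B : LinearMap.BilinForm ℝ (TangentSpace I x), ∀ X₀ Y₀ : TangentSpace I x,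
      B X₀ Y₀ = g.hessianAux f (FiberBundle.extend E X₀) (FiberBundle.extend E Y₀) x :=
    ⟨0, fun _ _ ↦ by simp [haux]⟩
  rw [dif_pos hex]
  ext X₀ Y₀
  simpa [haux] using hex.choose_spec X₀ Y₀

omit [CompleteSpace E] [Fact (1 ≤ n)] in
/-- **Locality of the Laplace–Beltrami operator**: `Δ_g f (x) = 0` if `f` vanishes near `x`
(`Δ_g f = tr_g Hess f`, O'Neill 1983, Ch. 3, Def. 3.50). [cite: ONeill1983, Ch. 3, Def. 3.50] -/
theorem dalembertian_eq_zero_of_eventuallyEq_zero {f : M → ℝ} {x : M}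
    (hf : f =ᶠ[𝓝 x] fun _ ↦ 0) : g.dalembertian f x = 0 := by
  simp [PseudoRiemannianMetric.dalembertian, g.hessian_eq_zero_of_eventuallyEq_zero hf,
    PseudoRiemannianMetric.trace]

omit [CompleteSpace E] [Fact (1 ≤ n)] in
/-- `Δ_g f` is supported in `tsupport f`. [folklore] -/
theorem dalembertian_eq_zero_of_notMem_tsupport {f : M → ℝ} {x : M} (hx : x ∉ tsupport f) :
    g.dalembertian f x = 0 := by
  refine g.dalembertian_eq_zero_of_eventuallyEq_zero ?_
  filter_upwards [(isClosed_tsupport f).isOpen_compl.mem_nhds hx] with y hy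
  exact image_eq_zero_of_notMem_tsupport hy

end Locality

end PseudoRiemannianMetric

/-! ### The identity with the compact support on `f` -/

section CompactF

variable {m : ℕ} {H : Type*} [TopologicalSpace H]
  {I : ModelWithCorners ℝ (EuclideanSpace ℝ (Fin m)) H} [I.Boundaryless]
  {N : Type*} [TopologicalSpace N] [ChartedSpace H N] [IsManifold I ∞ N]
  [T2Space N] [LocallyCompactSpace N] [SigmaCompactSpace N] [MeasurableSpace N] [BorelSpace N]
  (h : ContMDiffRiemannianMetric I ∞ (EuclideanSpace ℝ (Fin m)) (TangentSpace I : N → Type _))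
  [(ofRiemannian h).HasLeviCivita]

/-- **Green's first identity for compactly supported `f`**: on a Riemannian manifold `(N, h)`
modelled on `ℝ^m` (Hausdorff, locally compact, σ-compact), for `u ∈ C¹(N)` and `f ∈ C²_c(N)`,
`∫_N u Δ_h f dμ_h = −∫_N h⁻¹(du, df) dμ_h`. Proof: a smooth function `η` with compact support,
equal to `1` on a neighbourhood of `tsupport f` (Mathlib's `exists_contMDiffMap_zero_one_of_isClosed`
with `exists_isOpen_superset_and_isCompact_closure`), replaces `u` by `η u ∈ C¹_c(N)` without
changing either integrand (`Δ_h f` and `df` vanish off `tsupport f`,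
`dalembertian_eq_zero_of_notMem_tsupport`, `mvfderiv_eq_zero_of_notMem_tsupport`; `d(ηu) = du`
where `η ≡ 1`), and `integral_mul_dalembertian_eq_neg_integral_innerDual_of_hasCompactSupport`
applies. Lee 2018, Problem 2-23 (a). [cite: Lee2018, Problem 2-23 (a)] -/
theorem integral_mul_dalembertian_eq_neg_integral_innerDual_of_hasCompactSupport_right
    {u f : N → ℝ} (hu : CMDiff 1 u) (hf : CMDiff 2 f) (hfc : HasCompactSupport f) :
    ∫ p, u p * (ofRiemannian h).dalembertian f p ∂riemannianMeasure h =
      -∫ p, (ofRiemannian h).innerDual p (mvfderiv I u p).toLinearMap (mvfderiv I f p).toLinearMap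
        ∂riemannianMeasure h := by
  -- nested relatively compact open neighbourhoods `tsupport f ⊆ V₁ ⊆ closure V₁ ⊆ V₂`
  obtain ⟨V₁, hV₁o, hKV₁, hV₁c⟩ := exists_isOpen_superset_and_isCompact_closure hfc.isCompact
  obtain ⟨V₂, hV₂o, hV₁V₂, hV₂c⟩ := exists_isOpen_superset_and_isCompact_closure hV₁c
  -- a smooth `η` with `η = 0` off `V₂` and `η = 1` on `closure V₁`
  obtain ⟨η, hη0, hη1, -⟩ := exists_contMDiffMap_zero_one_of_isClosed (I := I) (n := (⊤ : ℕ∞))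
    hV₂o.isClosed_compl isClosed_closure (disjoint_compl_left_iff.2 hV₁V₂)
  have hηs : CMDiff 1 (η : N → ℝ) := η.contMDiff.of_le (by exact_mod_cast le_top)
  have hηc : HasCompactSupport (η : N → ℝ) := by
    refine HasCompactSupport.intro' hV₂c isClosed_closure (fun p hp ↦ hη0 ?_)
    exact fun hp2 ↦ hp (subset_closure hp2)
  have hw : CMDiff 1 (fun p ↦ η p * u p) := hηs.mul hu
  have hwc : HasCompactSupport (fun p ↦ η p * u p) := hηc.mul_right
  have key := integral_mul_dalembertian_eq_neg_integral_innerDual_of_hasCompactSupport h hw hwc hf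
  -- the left integrands agree
  have hL : (fun p ↦ (η p * u p) * (ofRiemannian h).dalembertian f p) =
      fun p ↦ u p * (ofRiemannian h).dalembertian f p := by
    funext p
    by_cases hp : p ∈ tsupport f
    · rw [hη1 (subset_closure (hKV₁ hp))]
      simp
    · rw [PseudoRiemannianMetric.dalembertian_eq_zero_of_notMem_tsupport _ hp]
      simp
  -- the right integrands agree
  have hR : (fun p ↦ (ofRiemannian h).innerDual p (mvfderiv I (fun p ↦ η p * u p) p).toLinearMap
      (mvfderiv I f p).toLinearMap) =
      fun p ↦ (ofRiemannian h).innerDual p (mvfderiv I u p).toLinearMap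
        (mvfderiv I f p).toLinearMap := by
    funext p
    by_cases hp : p ∈ tsupport f
    · have hev : (fun q ↦ η q * u q) =ᶠ[𝓝 p] u := by
        filter_upwards [hV₁o.mem_nhds (hKV₁ hp)] with q hq
        rw [hη1 (subset_closure hq)]
        simp
      rw [mvfderiv_congr_of_eventuallyEq hev]
    · rw [mvfderiv_eq_zero_of_notMem_tsupport hp]
      simp [PseudoRiemannianMetric.innerDual]
  rw [hL, hR] at key
  exact key

/-- **The integral of the Laplacian of a compactly supported function vanishes**:
`∫_N Δ_h f dμ_h = 0` for `f ∈ C²_c(N)` on any Riemannian manifold modelled on `ℝ^m` (Green's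
identity with `u = 1`, `du = 0`). Lee 2018, Problem 2-23 (c) (there for closed `N`).
[cite: Lee2018, Problem 2-23 (c)] -/
theorem integral_dalembertian_eq_zero_of_hasCompactSupport {f : N → ℝ} (hf : CMDiff 2 f)
    (hfc : HasCompactSupport f) :
    ∫ p, (ofRiemannian h).dalembertian f p ∂riemannianMeasure h = 0 := by
  have h1 := integral_mul_dalembertian_eq_neg_integral_innerDual_of_hasCompactSupport_right h
    (u := fun _ ↦ (1 : ℝ)) contMDiff_const hf hfc
  simp only [one_mul] at h1
  rw [h1]
  have h0 : ∀ p : N, mvfderiv I (fun _ : N ↦ (1 : ℝ)) p = 0 := fun p ↦ by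
    ext v
    simp [mvfderiv]
  simp [h0, PseudoRiemannianMetric.innerDual]

end CompactF

end Literature.Geometry.Lorentzian

end
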